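import Literature.MathematicalPhysics.QuantumFieldTheory.YangMillsOS

/-!
# drefute `orbit-kantorovich-finite-size` — face observables are admissible test functions of `contract`

Kernel-checked part of the stub-misstated finding on `stub_orbitKantorovichWindow`
(Negative-notes/stub_orbitKantorovichWindow.md): the dual-Lipschitz window condition
`IsKRWindow.contract` quantifies over every window-local `f` with cell-Lipschitz bounds in the
capped ORBIT weight `orbitWeight r α q`. We prove that this class contains every bounded Lipschitz
function of a SINGLE link `e` of a cell `c` whose two endpoints are non-interior sites of `c`
(e.g. a link lying in the outer face of an outer window cell, adjacent to the shell), with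
Lipschitz bound `δ = max D (L α)` on `c` and `0` elsewhere — although such an `f` is NOT invariant
under the would-be gauge rotation at the face site (the collective mode that only the six
straddling boundary plaquettes control). This is the observable used in the face-mode mechanism
(M1) of the note: `repDist ≤ cellDev` for such links because interior gauge transformations fix them.

Definitions `CoarseIdx … orbitWeight` are VERBATIM copies of the bodies in the skeleton
`Cruxes/LatticeGapOnTrajectory/Lines/orbit-kantorovich-finite-size.lean` (sha c58ba627e7b2;
the `Cruxes/…/Lines` module is not importable), in a scratch namespace, with the section's unused
instance variables (`IsTopologicalGroup`, `CompactSpace`, `MeasurableSpace`, `BorelSpace`) dropped.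
-/

set_option autoImplicit false

noncomputable section

namespace Summit.QuantumFields.YangMills.Cruxes.LatticeGapOnTrajectory.Drefute.OrbitKantorovich

open Literature.MathematicalPhysics.QuantumFieldTheory

/-! ## Verbatim copies of the skeleton's definitions -/

abbrev CoarseIdx (μ : Fin 4 → ℕ) : Type := (i : Fin 4) → ZMod (μ i + 1)

variable {ι V S : Type*}

structure IsCellLipBound (cell : V → ι) (w : ι → (V → S) → (V → S) → ℝ) (f : (V → S) → ℝ)
    (δ : ι → ℝ) : Prop where
  nonneg : ∀ c, 0 ≤ δ c
  le : ∀ (c : ι) (σ τ : V → S), (∀ v, cell v ≠ c → σ v = τ v) → |f σ - f τ| ≤ δ c * w c σ τ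

variable {G : Type} [Group G] [TopologicalSpace G]

variable {N : ℕ} {μ : Fin 4 → ℕ}

def siteCell (q : (i : Fin 4) → ZMod N → ZMod (μ i + 1)) (x : Site 4 N) : CoarseIdx μ :=
  fun i => q i (x i)

def cellOf (q : (i : Fin 4) → ZMod N → ZMod (μ i + 1)) (e : Edge 4 N) : CoarseIdx μ :=
  siteCell q e.1

def IsInteriorSite (q : (i : Fin 4) → ZMod N → ZMod (μ i + 1)) (c : CoarseIdx μ) (x : Site 4 N) : Prop :=
  siteCell q x = c ∧ ∀ i : Fin 4, siteCell q (x - Pi.single i 1) = c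

def IsInteriorGauge (q : (i : Fin 4) → ZMod N → ZMod (μ i + 1)) (c : CoarseIdx μ) (g : Site 4 N → G) :
    Prop :=
  ∀ x : Site 4 N, ¬ IsInteriorSite q c x → g x = 1

def repDist (r : LatticeRep G) (u v : G) : ℝ :=
  ∑ i, ∑ j, ‖r.ρ u i j - r.ρ v i j‖

def cellDev (r : LatticeRep G) (q : (i : Fin 4) → ZMod N → ZMod (μ i + 1)) (c : CoarseIdx μ)
    (U U' : GaugeConfig 4 N G) : ℝ :=
  ⨅ g : {g : Site 4 N → G // IsInteriorGauge q c g},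
    ⨆ e : {e : Edge 4 N // cellOf q e = c}, repDist r (U e.1) (gaugeTransform g.1 U' e.1)

def orbitWeight (r : LatticeRep G) (α : ℝ) (q : (i : Fin 4) → ZMod N → ZMod (μ i + 1)) (c : CoarseIdx μ)
    (U U' : GaugeConfig 4 N G) : ℝ :=
  min 1 (cellDev r q c U U' / α)

/-! ## Face links are fixed by interior gauge transformations -/

omit [TopologicalSpace G] in
/-- An interior gauge transformation of the cell `c` does not move a link whose two endpoints are
non-interior sites of `c` (both factors of `g(x) U_e g(x+eᵢ)⁻¹` are `1`). -/
theorem gaugeTransform_eq_of_not_interior {q : (i : Fin 4) → ZMod N → ZMod (μ i + 1)}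
    {c : CoarseIdx μ} {g : Site 4 N → G} (hg : IsInteriorGauge q c g) (U : GaugeConfig 4 N G)
    (e : Edge 4 N) (h1 : ¬ IsInteriorSite q c e.1) (h2 : ¬ IsInteriorSite q c (e.1.shift e.2)) :
    gaugeTransform g U e = U e := by
  simp [gaugeTransform, hg _ h1, hg _ h2]

/-- `repDist` is non-negative. -/
theorem repDist_nonneg (r : LatticeRep G) (u v : G) : 0 ≤ repDist r u v := by
  unfold repDist; positivity

/-- `cellDev` is non-negative. -/
theorem cellDev_nonneg (r : LatticeRep G) (q : (i : Fin 4) → ZMod N → ZMod (μ i + 1))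
    (c : CoarseIdx μ) (U U' : GaugeConfig 4 N G) : 0 ≤ cellDev r q c U U' :=
  Real.iInf_nonneg fun _ => Real.iSup_nonneg fun _ => repDist_nonneg r _ _

/-- **Face links are resolved by the orbit deviation.** For a link `e` of the cell `c` whose endpoints
are both non-interior, the plain representation distance of its two values is bounded by the
interior-orbit deviation `cellDev` of the cell (the `inf` over interior gauges cannot use `e`). -/
theorem repDist_le_cellDev [NeZero N] (r : LatticeRep G) (q : (i : Fin 4) → ZMod N → ZMod (μ i + 1))
    (c : CoarseIdx μ) (U U' : GaugeConfig 4 N G) (e : Edge 4 N) (he : cellOf q e = c)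
    (h1 : ¬ IsInteriorSite q c e.1) (h2 : ¬ IsInteriorSite q c (e.1.shift e.2)) :
    repDist r (U e) (U' e) ≤ cellDev r q c U U' := by
  unfold cellDev
  haveI : Nonempty {g : Site 4 N → G // IsInteriorGauge q c g} := ⟨⟨fun _ => 1, fun _ _ => rfl⟩⟩
  refine le_ciInf fun g => ?_
  have hbdd : BddAbove (Set.range fun e' : {e' : Edge 4 N // cellOf q e' = c} =>
      repDist r (U e'.1) (gaugeTransform g.1 U' e'.1)) := (Set.finite_range _).bddAbove
  calc repDist r (U e) (U' e) = repDist r (U e) (gaugeTransform g.1 U' e) := by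
        rw [gaugeTransform_eq_of_not_interior g.2 U' e h1 h2]
    _ ≤ ⨆ e' : {e' : Edge 4 N // cellOf q e' = c}, repDist r (U e'.1) (gaugeTransform g.1 U' e'.1) :=
        le_ciSup hbdd ⟨e, he⟩

/-! ## Single-face-link observables are admissible in `contract` -/

/-- **Admissibility of gauge-VARIANT face observables.** Let `e` be a link of the cell `c` with both
endpoints non-interior (a face link), `α > 0`, and `φ : G → ℝ` with `|φ u − φ v| ≤ L·repDist u v` and
`|φ u − φ v| ≤ D`. Then `f U := φ (U e)` has cell-Lipschitz bounds in the capped ORBIT weight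
`orbitWeight r α q` with `δ_c = max D (L α)` and `δ = 0` off `c` — so `f` is a legitimate test
function of `IsKRWindow.contract` although it is not invariant under the (would-be gauge) rotation
`U_e ↦ g U_e` at the face site `e.1` (e.g. `φ = ψ ∘ Re ∘ tr ∘ r.ρ`). -/
theorem isCellLipBound_faceObservable [NeZero N] (r : LatticeRep G)
    (q : (i : Fin 4) → ZMod N → ZMod (μ i + 1)) (c : CoarseIdx μ) (e : Edge 4 N) (he : cellOf q e = c)
    (h1 : ¬ IsInteriorSite q c e.1) (h2 : ¬ IsInteriorSite q c (e.1.shift e.2))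
    {α : ℝ} (hα : 0 < α) (φ : G → ℝ) {L D : ℝ} (hL : 0 ≤ L) (hD : 0 ≤ D)
    (hφL : ∀ u v, |φ u - φ v| ≤ L * repDist r u v) (hφD : ∀ u v, |φ u - φ v| ≤ D) :
    IsCellLipBound (cellOf q) (orbitWeight r α q) (fun U => φ (U e))
      (fun c' => if c' = c then max D (L * α) else 0) := by
  classical
  refine ⟨fun c' => ?_, fun c' σ τ hστ => ?_⟩
  · split_ifs
    · exact le_max_of_le_left hD
    · exact le_rfl
  by_cases hc : c' = c
  · subst hc
    simp only [if_true]
    have hrd := repDist_le_cellDev r q c' σ τ e he h1 h2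
    have hcd0 := cellDev_nonneg r q c' σ τ
    unfold orbitWeight
    set cd := cellDev r q c' σ τ with hcd
    rcases le_or_gt 1 (cd / α) with h | h
    · rw [min_eq_left h, mul_one]
      exact (hφD _ _).trans (le_max_left _ _)
    · rw [min_eq_right h.le]
      calc |φ (σ e) - φ (τ e)| ≤ L * repDist r (σ e) (τ e) := hφL _ _
        _ ≤ L * cd := mul_le_mul_of_nonneg_left hrd hL
        _ = (L * α) * (cd / α) := by field_simp
        _ ≤ max D (L * α) * (cd / α) :=
            mul_le_mul_of_nonneg_right (le_max_right _ _) (div_nonneg hcd0 hα.le)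
  · simp only [hc, if_false, zero_mul]
    have hce : cellOf q e ≠ c' := fun h' => hc (h'.symm ▸ he ▸ rfl)
    have : σ e = τ e := hστ e (by rw [he]; exact Ne.symm hc)
    simp [this]

end Summit.QuantumFields.YangMills.Cruxes.LatticeGapOnTrajectory.Drefute.OrbitKantorovich

end
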